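import Summits.BirchSwinnertonDyer.BirchSwinnertonDyer.Theorems.ThetaPartnerAtTwoSignedMainConjectureCMTwoRankZeroKatoDescentKSide
import Summits.BirchSwinnertonDyer.BirchSwinnertonDyer.Theorems.ThetaPartnerAtTwoSignedMainConjectureCMTwoRankZeroKatoDescentQSide
import Literature.NumberTheory.EllipticCurves.KatoFineSelmerDual
import Literature.NumberTheory.EllipticCurves.IwasawaAlgebraInvolution
import HarnessLib

/-!
# Kato's descent — file 6: clause (g)^ι of 26471's registered stub `stub_coreLowerCMTwo` from the TRANSPORT DATA
# (Kato Lemma 15.13 (1)/(15.13.1)/(15.13.2) + (15.16.1) + §15.15) as explicit binders — the end of the kernel chain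

Helper file for crux K2R0P♭ `stmt-BirchSwinnertonDyer-26471`
(`Summit.BirchSwinnertonDyer.BirchSwinnertonDyer.Theses.ThetaPartnerAtTwo.SignedMainConjectureCMTwoRankZeroOfPubOfFlat`,
route `ThetaPartnerAtTwo`, line `rankzero` v17 — ONE registered stub `stub_coreLowerCMTwo` = (CORE♭-lower), whose last conjunct is
(g)^ι `lengthAt Λ (I.H ⧸ Λ∙s) 𝔭′ ≤ lengthAt Λ Y.X (ι𝔭′)`; lead prover bsd-wall-tp2-p2 g9, 2026-08-28). BSD is not proved by any of
this; the theorem is an implication whose hypotheses carry all the (typed-fact) content.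

Files 1–5 proved the algebra between the printed K-tower equality (Johnson-Leung–Kings 2011 Thm. 5.7 / §7.2, the typer's
`thm57RegularShape_lengthAt_atPrime_eq_of_not_mem` on `D : Kato2004.EllipticUnitTower`) and clause (g)^ι: Kato's Lemma 14.15 (file 2), the
descent inequality and its K-side composition (files 3–4), the ℚ-side Thm. 12.4 (2) discharge and the length adapters (file 5). THIS FILE
assembles them: `lengthAt_quotient_span_le_of_transport` takes the content of Kato's Lemma 15.13 / (15.16.1) / §15.15 — which the tree cannot
yet STATE as facts for lack of carriers (corestriction along `ℚ_n ⊂ K(ζ_{2^{n+2}}) ⊂ K(2^{n+2}𝔣)`, the `ψ`-twist, an `O_K`-action on `T₂A`;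
typer design bsd-inputs-er2-ty1 evidence #26 §B on 24945, recommended unit «CyclotomicTransport») — as EXPLICIT BINDERS relative to the pinned
`D`, `I : Kato2004.IwasawaH1Data A 2 κ γ`, `Y : A.FineSelmerDualData κ γ`, `s ∈ 𝐇¹_Γ(T₂A)`, and concludes (g)^ι verbatim. Binder ↔ print:
`[IsNoetherianRing/IsDomain/KrullDimLE 2]`, `height_ne_one`, `a`, `a_mem`, `φ`, `φ_surjective`, `ker_φ` = Lemma 15.13 (1) ("`O_λ⟦G_{p^∞𝔣}⟧_𝔮` and
`O_λ⟦G_∞⟧_𝔭` are regular; the kernel … is a principal ideal `(a)`", with `A_𝔮/a ≅ O_λ⟦G_∞⟧_𝔭 → Λ_{𝔭′}` the `Δ`-projection reading, flag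
Kato-134-two-Delta of `Kato2004/EulerSystemBoundFineSelmerTwo`); `torsH` = §15.1 ("`𝔥¹` is torsion free") at `𝔮`; `ι`, `ι_smul`, `ker_ι`,
`length_coker_le` = (15.13.2) (`0 → H¹_𝔮/aH¹_𝔮 → 𝐇¹(T~)_𝔭 → H²_𝔮[a] → 0`); `ι_ell`, `s_ne_zero` = (15.16.1) + §15.15 (the image of `z_{p^∞𝔣}`
is Kato's zeta element, non-zero); `length_quot_le`, `length_quot_ne_top` = (15.13.1) (`H²_𝔮/aH²_𝔮 ≅ 𝐇²(T~)_𝔭`) read with Thm. 12.4 (1)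
and the Poitou–Tate identification `𝐇²(T~)_{𝔭′} ↔ X₀_{ι𝔭′}` off `(2)` (flag Kato-134-H20-fine; Thm. 12.5 (3): no local `𝐇²` term at
good reduction). The structure `CycTransportSocket` packaging these binders is filed separately (`…KatoDescentSocketDefs.lean`, review).

## References
* K. Kato, Astérisque 295 (2004), §15.1 (p. 251), Thm. 12.4–12.5 (pp. 221–222), Lemma 14.15 (pp. 243–244), Lemma 15.13, §15.15,
  (15.16.1), Prop. 15.17 (pp. 264–265).
* J. Johnson-Leung, G. Kings, J. reine angew. Math. 653 (2011), Thm. 5.7, §7.2.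
-/

set_option autoImplicit false
set_option linter.dupNamespace false

noncomputable section

open scoped Classical Pointwise NumberField

namespace Summit.BirchSwinnertonDyer.BirchSwinnertonDyer.Theorems.KatoDescent

open Literature.NumberTheory.EllipticCurves Literature.NumberTheory.EllipticCurves.Module
  Literature.NumberTheory.EllipticCurves.Kato2004 Literature.NumberTheory.GaloisRepresentations Field
  Literature.NumberTheory.ComplexMultiplication.EllipticUnits
open Literature.NumberTheory.ComplexMultiplication.EllipticUnits.Kato2004 (EllipticUnitTower)

section Transport

variable {K : Type} [Field K] [NumberField K] {𝔣 : Ideal (𝓞 K)} {ι₀ : K →+* ℂ}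
  {A : WeierstrassCurve ℚ} [A.IsElliptic] [ContinuousSMul ℤ_[2] (A.tateModule 2)]
  {κ : ZpExtension ℚ 2} {γ : absoluteGaloisGroup ℚ}

/-- **Clause (g)^ι from the TRANSPORT DATA as explicit binders** (the structure-free form of
`lengthAt_quotient_span_le_of_cycTransportSocket`, file 6b; see that file / `CycTransportSocket` for the field ↔ print map):
for the pinned tower `D` with `hreg`, `H2` finitely generated torsion, the JLK equality `Thm57RegularShape 2`, `Section151Shape`, a
topological generator `γ`, and the data of Kato Lemma 15.13 (1) (`A_𝔮` Noetherian local domain of dimension `≤ 2` with `ht 𝔪 ≠ 1`,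
`a ∈ 𝔪`, `φ : A_𝔮 ↠ Λ_{𝔭′}` with kernel in `(a)`, `(𝔥¹)_𝔮[a] = 0`), (15.13.2) (`ι` additive `φ`-semilinear with `ker ι = a(𝔥¹)_𝔮` and
`ℓ(W/ι) ≤ ℓ((𝔥²)_𝔮[a])`), (15.16.1)+§15.15 (`ι(ell/1) = s/1`, `s ≠ 0`) and (15.13.1) read against `X₀` (`ℓ((𝔥²)_𝔮/a) ≤ ℓ_{ι𝔭′}(X₀)`,
finite): **`lengthAt Λ (I.H ⧸ Λ∙s) 𝔭′ ≤ lengthAt Λ Y.X (ι𝔭′)`**.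
[cite: Kato2004Asterisque, Lemma 15.13, Prop. 15.17, §15.15, (15.16.1) (pp. 264–265), Lemma 14.15 (pp. 243–244), Thm. 12.4 (p. 221)]
[cite: JohnsonLeungKings2011, Thm. 5.7 and §7.2] -/
theorem lengthAt_quotient_span_le_of_transport
    (D : EllipticUnitTower K 2 𝔣 ι₀)
    (hreg : ∀ 𝔞 : EllipticUnitTower.TwistIdeals K 2 𝔣, IsSMulRegular D.Λ (D.nsub 𝔞.1))
    {H0 H2 : Type} [AddCommGroup H0] [Module D.Λ H0] [AddCommGroup H2] [Module D.Λ H2]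
    [Module.Finite D.Λ H2] (hH2 : Module.IsTorsion D.Λ H2)
    (hK : (D.toZetaSkeleton hreg H0 H2).Thm57RegularShape 2)
    (h151 : D.Section151Shape) (hγ : κ.IsTopGenerator γ)
    {𝔮 : PrimeSpectrum D.Λ} {𝔞 : Ideal (𝓞 K)} {I : IwasawaH1Data A 2 κ γ} {Y : A.FineSelmerDualData κ γ} {s : I.H}
    {𝔭' : PrimeSpectrum (IwasawaAlgebra 2)}
    -- the transport data (Kato L.15.13 (1)/(15.13.1)/(15.13.2), (15.16.1), §15.15), as explicit binders
    (two_not_mem : ((2 : ℕ) : D.Λ) ∉ 𝔮.asIdeal) (isTwist : IsTwist 2 𝔣 𝔞) (nsub_not_mem : D.nsub 𝔞 ∉ 𝔮.asIdeal)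
    [IsNoetherianRing (Localization.AtPrime 𝔮.asIdeal)] [IsDomain (Localization.AtPrime 𝔮.asIdeal)]
    [Ring.KrullDimLE 2 (Localization.AtPrime 𝔮.asIdeal)]
    (height_ne_one : (IsLocalRing.maximalIdeal (Localization.AtPrime 𝔮.asIdeal)).height ≠ 1)
    {a : Localization.AtPrime 𝔮.asIdeal} (a_mem : a ∈ IsLocalRing.maximalIdeal (Localization.AtPrime 𝔮.asIdeal))
    (φ : Localization.AtPrime 𝔮.asIdeal →+* Localization.AtPrime 𝔭'.asIdeal) (φ_surjective : Function.Surjective φ)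
    (ker_φ : ∀ b, φ b = 0 → b ∈ Ideal.span {a})
    (torsH : Submodule.torsionBy (Localization.AtPrime 𝔮.asIdeal) (LocalizedModule 𝔮.asIdeal.primeCompl D.H) a = ⊥)
    (ι : LocalizedModule 𝔮.asIdeal.primeCompl D.H →+ LocalizedModule 𝔭'.asIdeal.primeCompl I.H)
    (ι_smul : ∀ (b : Localization.AtPrime 𝔮.asIdeal) (x : LocalizedModule 𝔮.asIdeal.primeCompl D.H), ι (b • x) = φ b • ι x)
    (ker_ι : ∀ x : LocalizedModule 𝔮.asIdeal.primeCompl D.H,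
      ι x = 0 ↔ x ∈ a • (⊤ : Submodule (Localization.AtPrime 𝔮.asIdeal) (LocalizedModule 𝔮.asIdeal.primeCompl D.H)))
    (length_coker_le : Module.length (Localization.AtPrime 𝔭'.asIdeal)
        (LocalizedModule 𝔭'.asIdeal.primeCompl I.H ⧸
          Submodule.span (Localization.AtPrime 𝔭'.asIdeal) (Set.range ι)) ≤
      Module.length (Localization.AtPrime 𝔮.asIdeal)
        (Submodule.torsionBy (Localization.AtPrime 𝔮.asIdeal) (LocalizedModule 𝔮.asIdeal.primeCompl H2) a))
    (ι_ell : ι (LocalizedModule.mkLinearMap 𝔮.asIdeal.primeCompl D.H (D.ell 𝔞)) =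
      LocalizedModule.mkLinearMap 𝔭'.asIdeal.primeCompl I.H s)
    (s_ne_zero : s ≠ 0)
    (length_quot_le : Module.length (Localization.AtPrime 𝔮.asIdeal) (QuotSMulTop a (LocalizedModule 𝔮.asIdeal.primeCompl H2)) ≤
      lengthAt (IwasawaAlgebra 2) Y.X (PrimeSpectrum.comap (IwasawaAlgebra.invol 2).toRingHom 𝔭'))
    (length_quot_ne_top : Module.length (Localization.AtPrime 𝔮.asIdeal)
      (QuotSMulTop a (LocalizedModule 𝔮.asIdeal.primeCompl H2)) ≠ ⊤) :
    lengthAt (IwasawaAlgebra 2) (I.H ⧸ Submodule.span (IwasawaAlgebra 2) {s}) 𝔭' ≤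
      lengthAt (IwasawaAlgebra 2) Y.X (PrimeSpectrum.comap (IwasawaAlgebra.invol 2).toRingHom 𝔭') := by
  -- `W = (𝐇¹_Γ)_{𝔭′}` as an `A_𝔮`-module through `φ`
  letI instAlg : Algebra (Localization.AtPrime 𝔮.asIdeal) (Localization.AtPrime 𝔭'.asIdeal) := φ.toAlgebra
  letI instAW : Module (Localization.AtPrime 𝔮.asIdeal) (LocalizedModule 𝔭'.asIdeal.primeCompl I.H) :=
    Module.compHom (LocalizedModule 𝔭'.asIdeal.primeCompl I.H) φ
  haveI instST : IsScalarTower (Localization.AtPrime 𝔮.asIdeal) (Localization.AtPrime 𝔭'.asIdeal)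
      (LocalizedModule 𝔭'.asIdeal.primeCompl I.H) :=
    ⟨fun b c w ↦ by
      change (φ b * c) • w = φ b • (c • w)
      rw [mul_smul]⟩
  have hφW : ∀ (b : Localization.AtPrime 𝔮.asIdeal) (w : LocalizedModule 𝔭'.asIdeal.primeCompl I.H),
      b • w = φ b • w := fun _ _ ↦ rfl
  -- `ι` as an `A_𝔮`-linear map
  let ιA : LocalizedModule 𝔮.asIdeal.primeCompl D.H →ₗ[Localization.AtPrime 𝔮.asIdeal]
      LocalizedModule 𝔭'.asIdeal.primeCompl I.H :=
    { toFun := ι, map_add' := ι.map_add, map_smul' := fun b x ↦ by rw [ι_smul]; rfl }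
  have hιA : ∀ x, ιA x = ι x := fun _ ↦ rfl
  have hker : LinearMap.ker ιA = a • (⊤ : Submodule (Localization.AtPrime 𝔮.asIdeal)
      (LocalizedModule 𝔮.asIdeal.primeCompl D.H)) := by
    ext x
    rw [LinearMap.mem_ker, hιA]
    exact ker_ι x
  -- the range of `ι` is already a `Λ_{𝔭′}`-submodule (`φ` surjective)
  let RΛ : Submodule (Localization.AtPrime 𝔭'.asIdeal) (LocalizedModule 𝔭'.asIdeal.primeCompl I.H) :=
    { carrier := Set.range ι
      add_mem' := by
        rintro _ _ ⟨x, rfl⟩ ⟨y, rfl⟩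
        exact ⟨x + y, ι.map_add x y⟩
      zero_mem' := ⟨0, ι.map_zero⟩
      smul_mem' := by
        rintro c _ ⟨x, rfl⟩
        obtain ⟨b, rfl⟩ := φ_surjective c
        exact ⟨b • x, ι_smul b x⟩ }
  have hspan : Submodule.span (Localization.AtPrime 𝔭'.asIdeal) (Set.range ι) = RΛ := Submodule.span_eq RΛ
  have hres : RΛ.restrictScalars (Localization.AtPrime 𝔮.asIdeal) = LinearMap.range ιA := by
    ext w
    rw [Submodule.restrictScalars_mem, LinearMap.mem_range]
    exact Iff.rfl
  have hcoker : Module.length (Localization.AtPrime 𝔮.asIdeal)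
        (LocalizedModule 𝔭'.asIdeal.primeCompl I.H ⧸ LinearMap.range ιA) ≤
      Module.length (Localization.AtPrime 𝔮.asIdeal)
        (tors a (LocalizedModule 𝔮.asIdeal.primeCompl H2)) := by
    have h1 : Module.length (Localization.AtPrime 𝔮.asIdeal)
          (LocalizedModule 𝔭'.asIdeal.primeCompl I.H ⧸ RΛ) =
        Module.length (Localization.AtPrime 𝔭'.asIdeal) (LocalizedModule 𝔭'.asIdeal.primeCompl I.H ⧸ RΛ) :=
      Module.length_eq_of_surjective (S := Localization.AtPrime 𝔮.asIdeal)
        (R := Localization.AtPrime 𝔭'.asIdeal) (M := LocalizedModule 𝔭'.asIdeal.primeCompl I.H ⧸ RΛ)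
        (by rw [RingHom.algebraMap_toAlgebra]; exact φ_surjective)
    have h2 : Module.length (Localization.AtPrime 𝔮.asIdeal)
          (LocalizedModule 𝔭'.asIdeal.primeCompl I.H ⧸ LinearMap.range ιA) =
        Module.length (Localization.AtPrime 𝔮.asIdeal) (LocalizedModule 𝔭'.asIdeal.primeCompl I.H ⧸ RΛ) :=
      ((Submodule.quotEquivOfEq _ _ hres.symm) ≪≫ₗ
        (Submodule.Quotient.restrictScalarsEquiv (Localization.AtPrime 𝔮.asIdeal) RΛ)).length_eq
    rw [h2, h1, ← hspan]
    exact length_coker_le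
  -- Thm. 12.4 (2) on the ℚ-side
  have hz : ∀ b : Localization.AtPrime 𝔮.asIdeal,
      b • ιA (LocalizedModule.mkLinearMap 𝔮.asIdeal.primeCompl D.H (D.ell 𝔞)) = 0 → b ∈ Ideal.span {a} := by
    intro b hb
    rw [hιA, ι_ell] at hb
    exact iwasawaH1_mem_span_singleton_of_smul_mkLinearMap_eq_zero hγ I 𝔭' φ hφW ker_φ s_ne_zero b hb
  -- the descent inequality, K-side composed
  have main := length_quotient_span_ell_le_length_quotSMulTop_of_length_ne_top D hreg hH2 hK h151 𝔮
    two_not_mem isTwist nsub_not_mem height_ne_one a_mem torsH length_quot_ne_top ιA hker hcoker hz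
  rw [hιA, ι_ell] at main
  calc lengthAt (IwasawaAlgebra 2) (I.H ⧸ Submodule.span (IwasawaAlgebra 2) {s}) 𝔭'
      = Module.length (Localization.AtPrime 𝔭'.asIdeal)
          (LocalizedModule 𝔭'.asIdeal.primeCompl I.H ⧸
            Submodule.span (Localization.AtPrime 𝔭'.asIdeal)
              {LocalizedModule.mkLinearMap 𝔭'.asIdeal.primeCompl I.H s}) :=
        lengthAt_quotient_span_singleton_eq_length_localized s 𝔭'
    _ = Module.length (Localization.AtPrime 𝔮.asIdeal)
          (LocalizedModule 𝔭'.asIdeal.primeCompl I.H ⧸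
            Submodule.span (Localization.AtPrime 𝔮.asIdeal)
              {LocalizedModule.mkLinearMap 𝔭'.asIdeal.primeCompl I.H s}) :=
        (length_quotient_span_singleton_eq_of_surjective φ φ_surjective hφW _).symm
    _ ≤ Module.length (Localization.AtPrime 𝔮.asIdeal)
          (QuotSMulTop a (LocalizedModule 𝔮.asIdeal.primeCompl H2)) := main
    _ ≤ lengthAt (IwasawaAlgebra 2) Y.X (PrimeSpectrum.comap (IwasawaAlgebra.invol 2).toRingHom 𝔭') :=
        length_quot_le


end Transport

end Summit.BirchSwinnertonDyer.BirchSwinnertonDyer.Theorems.KatoDescent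

end
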